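import Literature.Probability.LatticeModels.NVectorInfraredBoundProofs
import HarnessLib

/-!
# Slice order of the anisotropic XY torus (route BalabanIR, support item `BirSliceXYOrderRP`):
# I. Geometry of the product torus `(ℤ/L)^d × (ℤ/M)^{d'}`

First file of the proof of `Summit.HubbardSuperconductivity.HubbardSuperconductivity.Theses.BalabanIR.BirSliceXYOrderRP`
(reflection positivity / infrared bound for the classical XY model on the anisotropic torus
`(ℤ/L)² × (ℤ/M)`, Fröhlich–Simon–Spencer 1976 as in Friedli–Velenik 2017 §10.5, ported from the
tree's cubic-torus files `GaussianDominationProofs.lean` / `NVectorInfraredBoundProofs.lean`).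

The anisotropic torus is modelled as the box product `torusGraph d L □ torusGraph d' M` of two of
the tree's cubic torus graphs (for the item: `d = 2`, `d' = 1`). This file supplies:
* the lift of a factor reflection `θ` with positive half `P` to the box product
  (`θ × id`, half `P ×ˢ univ`, and symmetrically), preserving the four hypotheses of the tree's
  reflection-positivity lemma `NVector.vZ_sq_le_reflect` (involution, automorphism, half exchange,
  crossing bonds are bisected);
* the enumeration of the edges of the product torus, each once, by sites and the `d + d'`
  directions (`sum_edgeFinset_boxTorus`), and the description of every edge as a jump edge.

## References
* S. Friedli, Y. Velenik, *Statistical Mechanics of Lattice Systems*, CUP 2017, §10.3 (reflections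
  of the torus), §10.5.3 (proof of Prop. 10.27). [FriedliVelenik2017]
* J. Fröhlich, B. Simon, T. Spencer, Comm. Math. Phys. 50 (1976) 79–95. [FrohlichSimonSpencer1976]
-/

namespace Summit.HubbardSuperconductivity.HubbardSuperconductivity.Theorems

namespace BirSliceXY

open Finset Literature.Probability.LatticeModels

/-! ### Reflections of a box product acting on one factor -/

section BoxReflection

variable {α β : Type*} (G : SimpleGraph α) (H : SimpleGraph β)

/-- An involution of the first factor lifts to an involution of the product. [folklore] -/
theorem prodCongr_left_apply_apply (θ : α ≃ α) (hθ : ∀ x, θ (θ x) = x) (p : α × β) :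
    (θ.prodCongr (Equiv.refl β)) ((θ.prodCongr (Equiv.refl β)) p) = p := by
  obtain ⟨a, b⟩ := p
  simp [hθ]

/-- An involution of the second factor lifts to an involution of the product. [folklore] -/
theorem prodCongr_right_apply_apply (θ : β ≃ β) (hθ : ∀ x, θ (θ x) = x) (p : α × β) :
    ((Equiv.refl α).prodCongr θ) (((Equiv.refl α).prodCongr θ) p) = p := by
  obtain ⟨a, b⟩ := p
  simp [hθ]

/-- An automorphism of the first factor lifts to an automorphism of the box product. [folklore] -/
theorem boxProd_adj_prodCongr_left (θ : α ≃ α) (hadj : ∀ x y, G.Adj (θ x) (θ y) ↔ G.Adj x y)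
    (p q : α × β) :
    (G □ H).Adj ((θ.prodCongr (Equiv.refl β)) p) ((θ.prodCongr (Equiv.refl β)) q) ↔
      (G □ H).Adj p q := by
  obtain ⟨a, b⟩ := p
  obtain ⟨a', b'⟩ := q
  simp [SimpleGraph.boxProd_adj, hadj, θ.injective.eq_iff]

/-- An automorphism of the second factor lifts to an automorphism of the box product. [folklore] -/
theorem boxProd_adj_prodCongr_right (θ : β ≃ β) (hadj : ∀ x y, H.Adj (θ x) (θ y) ↔ H.Adj x y)
    (p q : α × β) :
    (G □ H).Adj (((Equiv.refl α).prodCongr θ) p) (((Equiv.refl α).prodCongr θ) q) ↔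
      (G □ H).Adj p q := by
  obtain ⟨a, b⟩ := p
  obtain ⟨a', b'⟩ := q
  simp [SimpleGraph.boxProd_adj, hadj, θ.injective.eq_iff]

variable [Fintype α] [Fintype β]

omit [Fintype α] in
/-- If `θ` exchanges the half `P` of the first factor with its complement, then `θ × id`
exchanges `P × β` with its complement. [folklore] -/
theorem mem_product_univ_iff (θ : α ≃ α) (P : Finset α) (hP : ∀ x, x ∈ P ↔ θ x ∉ P)
    (p : α × β) :
    p ∈ P ×ˢ (univ : Finset β) ↔ (θ.prodCongr (Equiv.refl β)) p ∉ P ×ˢ (univ : Finset β) := by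
  obtain ⟨a, b⟩ := p
  simpa using hP a

omit [Fintype β] in
/-- If `θ` exchanges the half `P` of the second factor with its complement, then `id × θ`
exchanges `α × P` with its complement. [folklore] -/
theorem mem_univ_product_iff (θ : β ≃ β) (P : Finset β) (hP : ∀ x, x ∈ P ↔ θ x ∉ P)
    (p : α × β) :
    p ∈ (univ : Finset α) ×ˢ P ↔ ((Equiv.refl α).prodCongr θ) p ∉ (univ : Finset α) ×ˢ P := by
  obtain ⟨a, b⟩ := p
  simpa using hP b

omit [Fintype α] in
/-- Crossing bonds of the lifted reflection `θ × id` are bisected if those of `θ` are: a bond of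
the box product with exactly one endpoint in `P × β` joins `p` to `(θ × id) p`. [folklore] -/
theorem eq_prodCongr_left_of_adj (θ : α ≃ α) (P : Finset α)
    (hcross : ∀ x y, x ∈ P → y ∉ P → G.Adj x y → y = θ x) {p q : α × β}
    (hp : p ∈ P ×ˢ (univ : Finset β)) (hq : q ∉ P ×ˢ (univ : Finset β))
    (hpq : (G □ H).Adj p q) : q = (θ.prodCongr (Equiv.refl β)) p := by
  obtain ⟨a, b⟩ := p
  obtain ⟨a', b'⟩ := q
  simp only [Finset.mem_product, Finset.mem_univ, and_true] at hp hq
  rcases hpq with ⟨h1, h2⟩ | ⟨h1, h2⟩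
  · simp only at h1 h2
    subst h2
    simp [hcross a a' hp hq h1]
  · simp only at h1 h2
    subst h2
    exact absurd hp hq

omit [Fintype β] in
/-- Crossing bonds of the lifted reflection `id × θ` are bisected if those of `θ` are. [folklore] -/
theorem eq_prodCongr_right_of_adj (θ : β ≃ β) (P : Finset β)
    (hcross : ∀ x y, x ∈ P → y ∉ P → H.Adj x y → y = θ x) {p q : α × β}
    (hp : p ∈ (univ : Finset α) ×ˢ P) (hq : q ∉ (univ : Finset α) ×ˢ P)
    (hpq : (G □ H).Adj p q) : q = ((Equiv.refl α).prodCongr θ) p := by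
  obtain ⟨a, b⟩ := p
  obtain ⟨a', b'⟩ := q
  simp only [Finset.mem_product, Finset.mem_univ, true_and] at hp hq
  rcases hpq with ⟨h1, h2⟩ | ⟨h1, h2⟩
  · simp only at h1 h2
    subst h2
    exact absurd hp hq
  · simp only at h1 h2
    subst h2
    simp [hcross b b' hp hq h1]

end BoxReflection

/-! ### The product of two discrete tori: edges -/

section ProductTorus

variable {d d' L M : ℕ}

/-- `p ∼ p + (eᵢ, 0)` on the product torus (`L ≥ 2`). [folklore] -/
theorem boxTorus_adj_add_single_left (hL : 2 ≤ L) (p : TorusSite d L × TorusSite d' M)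
    (i : Fin d) : (torusGraph d L □ torusGraph d' M).Adj p (p.1 + Pi.single i 1, p.2) := by
  rw [SimpleGraph.boxProd_adj]
  exact Or.inl ⟨torusGraph_adj_add_single hL p.1 i, rfl⟩

/-- `p ∼ p + (0, eⱼ)` on the product torus (`M ≥ 2`). [folklore] -/
theorem boxTorus_adj_add_single_right (hM : 2 ≤ M) (p : TorusSite d L × TorusSite d' M)
    (j : Fin d') : (torusGraph d L □ torusGraph d' M).Adj p (p.1, p.2 + Pi.single j 1) := by
  rw [SimpleGraph.boxProd_adj]
  exact Or.inr ⟨torusGraph_adj_add_single hM p.2 j, rfl⟩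

/-- Every edge of the product torus is a jump edge `{p, p + (eᵢ, 0)}` or `{p, p + (0, eⱼ)}`.
[folklore] -/
theorem boxTorus_edge_cases {e : Sym2 (TorusSite d L × TorusSite d' M)}
    (he : e ∈ (torusGraph d L □ torusGraph d' M).edgeSet) :
    (∃ (p : TorusSite d L × TorusSite d' M) (i : Fin d), e = s(p, (p.1 + Pi.single i 1, p.2))) ∨
      ∃ (p : TorusSite d L × TorusSite d' M) (j : Fin d'), e = s(p, (p.1, p.2 + Pi.single j 1)) := by
  induction e using Sym2.ind with
  | _ a b =>
    have hab := (SimpleGraph.mem_edgeSet _).1 he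
    rcases hab with ⟨h1, h2⟩ | ⟨h1, h2⟩
    · rcases (torusGraph_adj_iff a.1 b.1).1 h1 with ⟨-, ⟨i, hi⟩ | ⟨i, hi⟩⟩
      · refine Or.inl ⟨a, i, ?_⟩
        have hb : b = (a.1 + Pi.single i 1, a.2) := Prod.ext hi h2.symm
        rw [hb]
      · refine Or.inl ⟨b, i, ?_⟩
        have ha : a = (b.1 + Pi.single i 1, b.2) := Prod.ext hi h2
        rw [ha, Sym2.eq_swap]
    · rcases (torusGraph_adj_iff a.2 b.2).1 h1 with ⟨-, ⟨j, hj⟩ | ⟨j, hj⟩⟩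
      · refine Or.inr ⟨a, j, ?_⟩
        have hb : b = (a.1, a.2 + Pi.single j 1) := Prod.ext h2.symm hj
        rw [hb]
      · refine Or.inr ⟨b, j, ?_⟩
        have ha : a = (b.1, b.2 + Pi.single j 1) := Prod.ext h2 hj
        rw [ha, Sym2.eq_swap]

/-- **The edges of the product torus, each counted once**: for `L, M ≥ 3` the map
`(p, i) ↦ {p, p + (eᵢ, 0)}`, `(p, j) ↦ {p, p + (0, eⱼ)}` is a bijection from
`Λ × ({1,…,d} ⊔ {1,…,d'})` onto the edge set, so that
`∑_{e ∈ E} F(e) = ∑_p (∑ᵢ F({p, p + (eᵢ,0)}) + ∑ⱼ F({p, p + (0,eⱼ)}))` (the anisotropic analogue of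
the tree's `sum_edgeFinset_torusGraph`). [folklore] -/
theorem sum_edgeFinset_boxTorus [NeZero L] [NeZero M] {A : Type*} [AddCommMonoid A]
    [DecidableRel (torusGraph d L □ torusGraph d' M).Adj] (hL : 3 ≤ L) (hM : 3 ≤ M)
    (F : Sym2 (TorusSite d L × TorusSite d' M) → A) :
    ∑ e ∈ (torusGraph d L □ torusGraph d' M).edgeFinset, F e =
      ∑ p : TorusSite d L × TorusSite d' M,
        (∑ i : Fin d, F s(p, (p.1 + Pi.single i 1, p.2)) +
          ∑ j : Fin d', F s(p, (p.1, p.2 + Pi.single j 1))) := by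
  classical
  have hL2 : 2 ≤ L := by omega
  have hM2 : 2 ≤ M := by omega
  set φ : (TorusSite d L × TorusSite d' M) × (Fin d ⊕ Fin d') →
      Sym2 (TorusSite d L × TorusSite d' M) := fun x =>
    Sum.elim (fun i => s(x.1, (x.1.1 + Pi.single i 1, x.1.2)))
      (fun j => s(x.1, (x.1.1, x.1.2 + Pi.single j 1))) x.2 with hφ
  have hφl : ∀ p i, φ (p, Sum.inl i) = s(p, (p.1 + Pi.single i 1, p.2)) := fun p i => rfl
  have hφr : ∀ p j, φ (p, Sum.inr j) = s(p, (p.1, p.2 + Pi.single j 1)) := fun p j => rfl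
  -- cancellation facts in the two factors
  have hne1 : ∀ i : Fin d, (Pi.single i 1 : TorusSite d L) ≠ 0 := torus_single_ne_zero hL2
  have hne2 : ∀ j : Fin d', (Pi.single j 1 : TorusSite d' M) ≠ 0 := torus_single_ne_zero hM2
  have hinj : Set.InjOn φ (univ : Finset ((TorusSite d L × TorusSite d' M) × (Fin d ⊕ Fin d'))) := by
    rintro ⟨p, u⟩ - ⟨q, v⟩ - h
    rcases u with i | j <;> rcases v with i' | j'
    · rw [hφl, hφl, Sym2.eq_iff] at h
      rcases h with ⟨rfl, h2⟩ | ⟨h1, h2⟩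
      · have := (Prod.ext_iff.1 h2).1
        exact Prod.ext rfl (congrArg Sum.inl (torus_single_injective hL2 (add_left_cancel this)))
      · exfalso
        have e1 := (Prod.ext_iff.1 h1).1
        have e2 := (Prod.ext_iff.1 h2).1
        simp only at e1 e2
        have h3 : q.1 + Pi.single i' 1 + Pi.single i 1 = q.1 := by rw [← e1, e2]
        rw [add_assoc, add_eq_left] at h3
        exact torus_single_add_single_ne_zero hL i' i h3
    · exfalso
      rw [hφl, hφr, Sym2.eq_iff] at h
      rcases h with ⟨rfl, h2⟩ | ⟨h1, h2⟩
      · have := (Prod.ext_iff.1 h2).1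
        simp only at this
        exact hne1 i (by simpa using this)
      · have e1 := (Prod.ext_iff.1 h1).1
        have e2 := (Prod.ext_iff.1 h2).1
        simp only at e1 e2
        rw [e1] at e2
        exact hne1 i (by simpa using e2)
    · exfalso
      rw [hφr, hφl, Sym2.eq_iff] at h
      rcases h with ⟨rfl, h2⟩ | ⟨h1, h2⟩
      · have := (Prod.ext_iff.1 h2).1
        simp only at this
        exact hne1 i' (by simpa using this.symm)
      · have e1 := (Prod.ext_iff.1 h1).1
        have e2 := (Prod.ext_iff.1 h2).1
        simp only at e1 e2
        rw [← e2] at e1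
        exact hne1 i' (by simpa using e1)
    · rw [hφr, hφr, Sym2.eq_iff] at h
      rcases h with ⟨rfl, h2⟩ | ⟨h1, h2⟩
      · have := (Prod.ext_iff.1 h2).2
        exact Prod.ext rfl (congrArg Sum.inr (torus_single_injective hM2 (add_left_cancel this)))
      · exfalso
        have e1 := (Prod.ext_iff.1 h1).2
        have e2 := (Prod.ext_iff.1 h2).2
        simp only at e1 e2
        have h3 : q.2 + Pi.single j' 1 + Pi.single j 1 = q.2 := by rw [← e1, e2]
        rw [add_assoc, add_eq_left] at h3
        exact torus_single_add_single_ne_zero hM j' j h3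
  have himage : (univ : Finset ((TorusSite d L × TorusSite d' M) × (Fin d ⊕ Fin d'))).image φ =
      (torusGraph d L □ torusGraph d' M).edgeFinset := by
    ext e
    simp only [Finset.mem_image, Finset.mem_univ, true_and, SimpleGraph.mem_edgeFinset]
    constructor
    · rintro ⟨⟨p, u⟩, rfl⟩
      rcases u with i | j
      · exact (SimpleGraph.mem_edgeSet _).2 (boxTorus_adj_add_single_left hL2 p i)
      · exact (SimpleGraph.mem_edgeSet _).2 (boxTorus_adj_add_single_right hM2 p j)
    · intro he
      rcases boxTorus_edge_cases he with ⟨p, i, rfl⟩ | ⟨p, j, rfl⟩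
      · exact ⟨(p, Sum.inl i), rfl⟩
      · exact ⟨(p, Sum.inr j), rfl⟩
  rw [← himage, Finset.sum_image hinj, ← Finset.univ_product_univ, Finset.sum_product]
  refine Finset.sum_congr rfl fun p _ => ?_
  rw [← Finset.univ_disjSum_univ, Finset.sum_disjSum]
  rfl

end ProductTorus

/-! ### The bond reflections of the product torus -/

section ProductReflections

variable {d d' L M : ℕ} [NeZero L] [NeZero M]

/-- **The reflection `θ × id` of the product torus through the planes bisecting the bonds in
direction `i` of the first factor satisfies the hypotheses of reflection positivity**
(involution; automorphism of the box product; exchanges the half `𝕋₊ × 𝕋'` with its complement for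
even `L`; a bond with exactly one endpoint in the half is bisected, `L ≥ 4` even). [folklore] -/
theorem reflect_left_hyps (hL : Even L) (hL4 : 4 ≤ L) (i : Fin d) (k : ZMod L) :
    (∀ p : TorusSite d L × TorusSite d' M,
        ((Torus.reflectBetweenSites i k).prodCongr (Equiv.refl (TorusSite d' M)))
          (((Torus.reflectBetweenSites i k).prodCongr (Equiv.refl (TorusSite d' M))) p) = p) ∧
    (∀ p q : TorusSite d L × TorusSite d' M,
        (torusGraph d L □ torusGraph d' M).Adj
            (((Torus.reflectBetweenSites i k).prodCongr (Equiv.refl (TorusSite d' M))) p)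
            (((Torus.reflectBetweenSites i k).prodCongr (Equiv.refl (TorusSite d' M))) q) ↔
          (torusGraph d L □ torusGraph d' M).Adj p q) ∧
    (∀ p : TorusSite d L × TorusSite d' M,
        p ∈ (Torus.halfBetweenSites i k).toFinset ×ˢ (univ : Finset (TorusSite d' M)) ↔
          ((Torus.reflectBetweenSites i k).prodCongr (Equiv.refl (TorusSite d' M))) p ∉
            (Torus.halfBetweenSites i k).toFinset ×ˢ (univ : Finset (TorusSite d' M))) ∧
    (∀ p q : TorusSite d L × TorusSite d' M,
        p ∈ (Torus.halfBetweenSites i k).toFinset ×ˢ (univ : Finset (TorusSite d' M)) →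
        q ∉ (Torus.halfBetweenSites i k).toFinset ×ˢ (univ : Finset (TorusSite d' M)) →
        (torusGraph d L □ torusGraph d' M).Adj p q →
          q = ((Torus.reflectBetweenSites i k).prodCongr (Equiv.refl (TorusSite d' M))) p) :=
  ⟨prodCongr_left_apply_apply _ (Torus.reflectBetweenSites_involutive i k),
    boxProd_adj_prodCongr_left _ _ _ (Torus.torusGraph_adj_reflectBetweenSites_iff i k),
    mem_product_univ_iff _ _ (Torus.mem_halfBetweenSites_iff_reflect_not_mem hL i k),
    fun _ _ hp hq hpq => eq_prodCongr_left_of_adj _ _ _ _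
      (fun _ _ hx hy hxy => Torus.eq_reflectBetweenSites_of_adj hL hL4 i k hx hy hxy) hp hq hpq⟩

/-- **The reflection `id × θ` of the product torus through the planes bisecting the bonds in
direction `j` of the second factor satisfies the hypotheses of reflection positivity**
(`M ≥ 4` even). [folklore] -/
theorem reflect_right_hyps (hM : Even M) (hM4 : 4 ≤ M) (j : Fin d') (k : ZMod M) :
    (∀ p : TorusSite d L × TorusSite d' M,
        ((Equiv.refl (TorusSite d L)).prodCongr (Torus.reflectBetweenSites j k))
          (((Equiv.refl (TorusSite d L)).prodCongr (Torus.reflectBetweenSites j k)) p) = p) ∧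
    (∀ p q : TorusSite d L × TorusSite d' M,
        (torusGraph d L □ torusGraph d' M).Adj
            (((Equiv.refl (TorusSite d L)).prodCongr (Torus.reflectBetweenSites j k)) p)
            (((Equiv.refl (TorusSite d L)).prodCongr (Torus.reflectBetweenSites j k)) q) ↔
          (torusGraph d L □ torusGraph d' M).Adj p q) ∧
    (∀ p : TorusSite d L × TorusSite d' M,
        p ∈ (univ : Finset (TorusSite d L)) ×ˢ (Torus.halfBetweenSites j k).toFinset ↔
          ((Equiv.refl (TorusSite d L)).prodCongr (Torus.reflectBetweenSites j k)) p ∉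
            (univ : Finset (TorusSite d L)) ×ˢ (Torus.halfBetweenSites j k).toFinset) ∧
    (∀ p q : TorusSite d L × TorusSite d' M,
        p ∈ (univ : Finset (TorusSite d L)) ×ˢ (Torus.halfBetweenSites j k).toFinset →
        q ∉ (univ : Finset (TorusSite d L)) ×ˢ (Torus.halfBetweenSites j k).toFinset →
        (torusGraph d L □ torusGraph d' M).Adj p q →
          q = ((Equiv.refl (TorusSite d L)).prodCongr (Torus.reflectBetweenSites j k)) p) :=
  ⟨prodCongr_right_apply_apply _ (Torus.reflectBetweenSites_involutive j k),
    boxProd_adj_prodCongr_right _ _ _ (Torus.torusGraph_adj_reflectBetweenSites_iff j k),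
    mem_univ_product_iff _ _ (Torus.mem_halfBetweenSites_iff_reflect_not_mem hM j k),
    fun _ _ hp hq hpq => eq_prodCongr_right_of_adj _ _ _ _
      (fun _ _ hx hy hxy => Torus.eq_reflectBetweenSites_of_adj hM hM4 j k hx hy hxy) hp hq hpq⟩

/-- The bond `{p, p + (eᵢ, 0)}` is bisected by the mirror of `θ_{i, p.1 i} × id`: its far endpoint
lies in the positive half and is reflected onto `p` (`L ≥ 2`). [folklore] -/
theorem add_single_left_mem_half (hL2 : 2 ≤ L) (i : Fin d) (p : TorusSite d L × TorusSite d' M) :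
    (p.1 + Pi.single i 1, p.2) ∈
        (Torus.halfBetweenSites i (p.1 i)).toFinset ×ˢ (univ : Finset (TorusSite d' M)) ∧
      ((Torus.reflectBetweenSites i (p.1 i)).prodCongr (Equiv.refl (TorusSite d' M)))
          (p.1 + Pi.single i 1, p.2) = p := by
  obtain ⟨h1, h2⟩ := Torus.add_single_mem_halfBetweenSites (d := d) hL2 i p.1
  refine ⟨Finset.mem_product.2 ⟨h1, Finset.mem_univ _⟩, ?_⟩
  obtain ⟨a, b⟩ := p
  simp only [Equiv.prodCongr_apply, Equiv.coe_refl, Prod.map_apply, id_eq] at h2 ⊢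
  rw [h2]

/-- The bond `{p, p + (0, eⱼ)}` is bisected by the mirror of `id × θ_{j, p.2 j}` (`M ≥ 2`).
[folklore] -/
theorem add_single_right_mem_half (hM2 : 2 ≤ M) (j : Fin d') (p : TorusSite d L × TorusSite d' M) :
    (p.1, p.2 + Pi.single j 1) ∈
        (univ : Finset (TorusSite d L)) ×ˢ (Torus.halfBetweenSites j (p.2 j)).toFinset ∧
      ((Equiv.refl (TorusSite d L)).prodCongr (Torus.reflectBetweenSites j (p.2 j)))
          (p.1, p.2 + Pi.single j 1) = p := by
  obtain ⟨h1, h2⟩ := Torus.add_single_mem_halfBetweenSites (d := d') hM2 j p.2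
  refine ⟨Finset.mem_product.2 ⟨Finset.mem_univ _, h1⟩, ?_⟩
  obtain ⟨a, b⟩ := p
  simp only [Equiv.prodCongr_apply, Equiv.coe_refl, Prod.map_apply, id_eq] at h2 ⊢
  rw [h2]

end ProductReflections

end BirSliceXY

end Summit.HubbardSuperconductivity.HubbardSuperconductivity.Theorems
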